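import Literature.AnabelianGeometry.EtaleTheta.SettingModelChiConjCentre
import Literature.AnabelianGeometry.EtaleTheta.SettingModelCyclotomicCharacter
import HarnessLib

/-!
# Twisted root models of [EtTh] §1 (R78) — conjugation on the theta centre through `χ`, for ANY twist with
# diagonal degree-zero shadow (stage 1 `θ_χ` and the stage-2 «Tate shear» alike)

Mochizuki, *The étale theta function …*, Publ. RIMS **45** (2009) [EtTh], §1, PRIMS PDF p. 12
[cite: MochizukiEtTh2009, §1 p.12]: "`(Ẑ(1) ≅) Δ_Θ`". Layer L2 of the abc-iut cell (seat abc-iut-L6-d6 gen 4;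
abc-iut-L2-lead gen 3 RULINGS #13 R100, R78-MAP #5 stage-2 item F1q), PROOF-ONLY generalisation of this seat's
`SettingModelChiConjCentre.lean` from the diagonal action `actχ = twistGfp ∘ χ` to an ARBITRARY action
`φ : G_{ℚ_p} → Aut Γ` (`Γ = F̂₂ ×_Ẑ ℤ`) whose level-`N` shadow ON THE DEGREE-ZERO PART `Ker(Γ ↠ ℤ)` is the
diagonal twist `diagTwist (χ_N σ)` — hypothesis `hφ0` below. It holds for stage 1 (abc-iut-w5-d024's
`hHat_gfpFst_twistGfp`, all of `Γ`) and for the stage-2 affine action `a ↦ a·b^k·c^m`, `b ↦ b^{χ}` of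
abc-iut-L2-t6 (`hHat_gfpFst_affTwist₃Gfp_of_gfpSnd_eq_one`, degree-zero part only — the shear does NOT descend to
`Heis(ℤ/N)` off degree zero), composed with abc-iut-L2-t5's `cocyclePairHom`.

* `GfpTwist.gfpSnd_eq_one_of_mem_closure` — elements of `Γ` over the derived closure `[F̂₂,F̂₂]⁻` have degree `0`;
* `GfpTwist.right_conj_inl`, `GfpTwist.left_conj_inl` — conjugating `inl γ` in `Γ ⋊_φ G_{ℚ_p}`;
* **`GfpTwist.hHat_gfpFst_left_conj_inl_of_mem_closure`** — for `γ` over `[F̂₂,F̂₂]⁻` and any `g = (g_Γ, σ)`: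
  `ĥ_N(g·γ·g⁻¹) = (0, 0, χ_N(σ)·z_N(γ))` — conjugation acts on the centre's `Ẑ`-coordinate by `χ`, the geometric
  part trivially, WHATEVER the shear;
* `GfpTwist.conj_inl_cPow_mul_inv_mem_closure₃` — the conjugate of `inl(c^t)` over `σ` is `≡ inl(c^{χ(σ)t})`
  modulo `inl([[F̂₂,F̂₂],F̂₂]⁻)`.

SEMI-SYNTHETIC MODELS; consistency evidence only; nothing of [EtTh] is asserted; no side is taken on
[IUTchIII] Cor. 3.12. No definitions, no instances, no Prop facts.
-/

noncomputable section

namespace Literature.AnabelianGeometry.EtaleTheta.SettingModel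

namespace GfpTwist

open Literature.AnabelianGeometry.SemiGraphs
open Function
open scoped commutatorElement

variable (p : ℕ) [Fact p.Prime] (φ : GQp p →* MulAut Gfp)

/-- An element of `Γ` whose `F̂₂`-component lies in `[F̂₂,F̂₂]⁻` has degree `0` (its `x`-coordinates vanish at
every level, so `ê = 1`). [cite: MochizukiEtTh2009, §1 p.12] -/
theorem gfpSnd_eq_one_of_mem_closure {γ : Gfp}
    (hγ : gfpFst γ ∈ (⁅(⊤ : Subgroup F₂hatT), (⊤ : Subgroup F₂hatT)⁆).topologicalClosure) : gfpSnd γ = 1 := by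
  have hx := fun N => ((mem_closure_commutator₂_iff_forall_hHat (gfpFst γ)).mp hγ N).1
  have he : eHat (gfpFst γ) = 1 := by
    refine ext_of_modN fun N => ?_
    rw [← hHat_x_eq_modN_eHat, hx N, ofAdd_zero, map_one]
  have hq := (mem_Gfp _).mp γ.2
  rw [gfpFst_apply] at he
  rw [he] at hq
  exact iotaZ_injective (by rw [map_one]; exact hq.symm)

/-- The arithmetic component of a conjugate of `inl γ` is trivial. [cite: MochizukiEtTh2009, §1 p.12] -/
theorem right_conj_inl (g : Gfp ⋊[φ] GQp p) (γ : Gfp) :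
    (g * SemidirectProduct.inl γ * g⁻¹).right = 1 := by
  simp [SemidirectProduct.mul_right, SemidirectProduct.inv_right]

/-- The `Γ`-component of `g · inl γ · g⁻¹` is `g_Γ · φ_σ(γ) · g_Γ⁻¹`. [cite: MochizukiEtTh2009, §1 p.12] -/
theorem left_conj_inl (g : Gfp ⋊[φ] GQp p) (γ : Gfp) :
    (g * SemidirectProduct.inl γ * g⁻¹).left = g.left * φ g.right γ * g.left⁻¹ := by
  simp only [SemidirectProduct.mul_left, SemidirectProduct.mul_right, SemidirectProduct.inv_left,
    SemidirectProduct.left_inl, SemidirectProduct.right_inl, mul_one, map_inv, MulAut.apply_inv_self]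

/-- An element of the `z`-axis of `Heis R` is central. [folklore] -/
private theorem Heis.conj_eq_of_x_eq_zero_of_y_eq_zero' {R : Type*} [CommRing R] (h d : Heis R) (hx : d.x = 0)
    (hy : d.y = 0) : h * d * h⁻¹ = d := by
  have hc := Heis.zAxis_le_center (R := R) (show d ∈ Heis.zAxis from ⟨hx, hy⟩)
  rw [Subgroup.mem_center_iff] at hc
  rw [hc h, mul_inv_cancel_right]

variable (hφ0 : ∀ (N : ℕ+) (σ : GQp p) (q : Gfp), gfpSnd q = 1 →
  hHat N (gfpFst (φ σ q)) = Heis.diagTwist (ZHatLevel.levelChar N (chi p σ)) (hHat N (gfpFst q)))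
include hφ0

/-- **Conjugation acts on the theta centre through `χ`, for any twist with diagonal degree-zero shadow.** For
`γ ∈ Γ` over the derived closure and any `g = (g_Γ, σ)`: `ĥ_N(g·γ·g⁻¹) = (0, 0, χ_N(σ)·z_N(γ))`.
[cite: MochizukiEtTh2009, §1 p.12] -/
theorem hHat_gfpFst_left_conj_inl_of_mem_closure (g : Gfp ⋊[φ] GQp p) {γ : Gfp}
    (hγ : gfpFst γ ∈ (⁅(⊤ : Subgroup F₂hatT), (⊤ : Subgroup F₂hatT)⁆).topologicalClosure) (N : ℕ+) :
    hHat N (gfpFst (g * SemidirectProduct.inl γ * g⁻¹).left) =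
      ⟨0, 0, ZHatLevel.levelChar N (chi p g.right) * (hHat N (gfpFst γ)).z⟩ := by
  obtain ⟨hx, hy⟩ := (mem_closure_commutator₂_iff_forall_hHat (gfpFst γ)).mp hγ N
  have hD : hHat N (gfpFst (φ g.right γ)) = ⟨0, 0, ZHatLevel.levelChar N (chi p g.right) * (hHat N (gfpFst γ)).z⟩ := by
    rw [hφ0 N g.right γ (gfpSnd_eq_one_of_mem_closure hγ)]
    ext <;> simp [hx, hy]
  rw [left_conj_inl]
  simp only [map_mul, map_inv]
  rw [hD]
  exact Heis.conj_eq_of_x_eq_zero_of_y_eq_zero' _ _ rfl rfl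

/-- The conjugate stays over the derived closure. [cite: MochizukiEtTh2009, §1 p.12] -/
theorem gfpFst_left_conj_inl_mem_closure (g : Gfp ⋊[φ] GQp p) {γ : Gfp}
    (hγ : gfpFst γ ∈ (⁅(⊤ : Subgroup F₂hatT), (⊤ : Subgroup F₂hatT)⁆).topologicalClosure) :
    gfpFst (g * SemidirectProduct.inl γ * g⁻¹).left ∈
      (⁅(⊤ : Subgroup F₂hatT), (⊤ : Subgroup F₂hatT)⁆).topologicalClosure := by
  rw [mem_closure_commutator₂_iff_forall_hHat]
  intro N
  rw [hHat_gfpFst_left_conj_inl_of_mem_closure p φ hφ0 g hγ N]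
  exact ⟨rfl, rfl⟩

/-- **The conjugate of `inl(c^t)` over `σ` is `≡ inl(c^{χ(σ)·t})` modulo `inl([[F̂₂,F̂₂],F̂₂]⁻)`**, for any
`c^·` with `ι 1 ↦ η⁅a,b⁆` and any twist with diagonal degree-zero shadow. [cite: MochizukiEtTh2009, §1 p.12] -/
theorem conj_inl_cPow_mul_inv_mem_closure₃ (f : ZH →ₜ* F₂hatT)
    (hf : f (iotaZ (Multiplicative.ofAdd 1)) = eta ⁅FreeGroup.of (0 : Fin 2), FreeGroup.of 1⁆)
    (g : Gfp ⋊[φ] GQp p) (t : ZH) :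
    gfpFst (g * SemidirectProduct.inl (⟨(f t, 1), cPow_mk_mem_Gfp f hf t⟩ : Gfp) * g⁻¹).left *
        (f (chi p g.right t))⁻¹ ∈
      (⁅⁅(⊤ : Subgroup F₂hatT), (⊤ : Subgroup F₂hatT)⁆, (⊤ : Subgroup F₂hatT)⁆).topologicalClosure := by
  have hγ : gfpFst (⟨(f t, 1), cPow_mk_mem_Gfp f hf t⟩ : Gfp) ∈
      (⁅(⊤ : Subgroup F₂hatT), (⊤ : Subgroup F₂hatT)⁆).topologicalClosure :=
    apply_mem_closure_commutator_of_cPowSpec f hf t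
  rw [mem_closure_commutator₃_iff_forall_hHat]
  intro N
  rw [map_mul, map_inv, hHat_gfpFst_left_conj_inl_of_mem_closure p φ hφ0 g hγ N, hHat_apply_of_cPowSpec f hf,
    modN_eq_level, ZHatLevel.toAdd_level_aut]
  have : (hHat N (gfpFst (⟨(f t, 1), cPow_mk_mem_Gfp f hf t⟩ : Gfp))).z = Multiplicative.toAdd (ZHatLevel.level N t) := by
    show (hHat N (f t)).z = _
    rw [hHat_apply_of_cPowSpec f hf, modN_eq_level]
  rw [this]
  ext <;> simp

end GfpTwist

/-! ### The stage-1 instance of the hypothesis -/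

open Literature.AnabelianGeometry.SemiGraphs in
variable (p : ℕ) [Fact p.Prime] in

/-- Stage 1: the diagonal action `actχ = twistGfp ∘ χ` has diagonal shadow at every level on ALL of `Γ`
(abc-iut-w5-d024's `hHat_gfpFst_twistGfp`). [cite: MochizukiEtTh2009, §1 p.12] -/
theorem actχ_degreeZero_shadow (N : ℕ+) (σ : GQp p) (q : Gfp) (_hq : gfpSnd q = 1) :
    hHat N (gfpFst (actχ p σ q)) = Heis.diagTwist (ZHatLevel.levelChar N (chi p σ)) (hHat N (gfpFst q)) :=
  hHat_gfpFst_twistGfp N (chi p σ) q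

end Literature.AnabelianGeometry.EtaleTheta.SettingModel

end
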